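import Literature.Barriers.CriticalPhenomena.HaraGaussianLemmaTorusIBP
import Literature.Barriers.CriticalPhenomena.LaceExpansionKernelTaylor
import Mathlib.Analysis.Calculus.IteratedDeriv.Lemmas
import Mathlib.MeasureTheory.Constructions.HaarToSphere
import HarnessLib

/-!
# Slicing integrals over `[-π,π]^d`, iterated periodic integration by parts, and `∫ |k|^{-p}`

Barrier catalogue `Literature/Barriers/CriticalPhenomena/` (D-0021), measure-theoretic infrastructure
for the analytic named fact `Hara2008_lemma17Pc` (Hara 2008, Lemma 1.7; `LaceExpansionXSpaceNorms.lean`)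
behind `Hara2008_xSpacePiBoundPc`. Hara's §4.1 turns `k`-space derivative bounds
`|∂_j^m Ĝ(k)| ≤ c|k|^{-2-m}` (Lemma 4.1) into `x`-space decay through
`G_j^{(2n)}(x) = |x_j|^{2n} G(x) = (-1)^n ∫ e^{ikx} ∂_j^{2n} Ĝ(k) d^dk/(2π)^d` ((4.8)) and
"`G_j^{(α)}(a) ≤ ∫ |Ĝ_j^{(α)}(k)| ≤ ∫ c/|k|^{2+α}`, which is finite for `2 + α < d`" ((4.9)). Since
`Ĝ` is singular at `k = 0`, the integration by parts is done here SLICE-WISE: the cube is cut along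
the coordinate `l` (`MeasurableEquiv.piFinSuccAbove`, as in `HaraGaussianLemmaTorusIBP.lean`), the
one-dimensional slices avoid the origin for almost every transverse momentum, and on each slice the
classical periodic integration by parts is iterated. PROVED here, all [folklore]:

* `intervalIntegral_cexp_mul_deriv_eq` / `intervalIntegral_cexp_mul_iteratedDeriv_eq` — for a
  `2π`-periodic `C^m` function `F : ℝ → ℂ` and `y ∈ ℤ`,
  `∫_{-π}^{π} e^{isy} F^{(m)}(s) ds = (-iy)^m ∫_{-π}^{π} e^{isy} F(s) ds`;
* `integral_cube_succ_eq_iterated_of_integrable` — Fubini on the cube for an INTEGRABLE `H`: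
  `∫_{[-π,π]^{n+1}} H = ∫_{[-π,π]^n} ∫_{[-π,π]} H(ins_l(s,k')) ds dk'`, with the integrability of the
  transverse functions `k' ↦ ∫ H(ins_l(s,k')) ds`, `k' ↦ ∫ ‖H(ins_l(s,k'))‖ ds`;
* the geometry of slices: `|ins_l(s,k')|² = s² + |k'|²`, `ins_l(s,k') ≠ 0` for `k' ≠ 0`;
* `integrableOn_knorm_rpow_neg` — `∫_{[-π,π]^d} |k|^{-p} dk < ∞` for `p < d` (polar coordinates,
  Mathlib's `integrableOn_fun_norm_addHaar`, comparing `|k|` with the sup norm).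

## References

* T. Hara, Ann. Probab. 36 (2008) 530–593 (arXiv:math-ph/0504021): §4.1.1–§4.1.2 ((4.3), (4.8),
  (4.9): "which is finite for `2 + α < d`").
-/

noncomputable section

namespace Literature.Barriers.CriticalPhenomena

open _root_.MeasureTheory Filter Finset Literature.Probability.LatticeModels
  Literature.Probability.Percolation
open scoped Topology BigOperators

/-! ### Iterated periodic integration by parts against a character -/

/-- `e^{iπy} = e^{-iπy}` for `y ∈ ℤ`. [folklore] -/
theorem cexp_I_pi_mul_int_eq (y : ℤ) :
    Complex.exp (Complex.I * ((Real.pi : ℂ) * (y : ℂ))) =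
      Complex.exp (Complex.I * ((-Real.pi : ℝ) * (y : ℂ))) := by
  push_cast
  rw [show Complex.I * ((Real.pi : ℂ) * (y : ℂ)) =
    Complex.I * (-(Real.pi : ℂ) * (y : ℂ)) + y * (2 * Real.pi * Complex.I) by ring,
    Complex.exp_add, Complex.exp_int_mul_two_pi_mul_I, mul_one]

/-- The character `s ↦ e^{isy}` has derivative `iy e^{isy}`. [folklore] -/
theorem hasDerivAt_cexp_I_mul_mul (y : ℂ) (s : ℝ) :
    HasDerivAt (fun s : ℝ => Complex.exp (Complex.I * ((s : ℂ) * y)))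
      (Complex.I * y * Complex.exp (Complex.I * ((s : ℂ) * y))) s := by
  have h1 : HasDerivAt (fun s : ℝ => Complex.I * ((s : ℂ) * y)) (Complex.I * y) s := by
    have h := ((hasDerivAt_id s).ofReal_comp).mul_const y
    simpa using h.const_mul Complex.I
  convert h1.cexp using 1
  ring

/-- **One periodic integration by parts against a character**: if `G` has the continuous
derivative `G'` and `G(π) = G(-π)`, then for `y ∈ ℤ`,
`∫_{-π}^{π} e^{isy} G'(s) ds = -iy ∫_{-π}^{π} e^{isy} G(s) ds` (the boundary terms cancel).
[folklore] -/
theorem intervalIntegral_cexp_mul_deriv_eq {G G' : ℝ → ℂ} (hG : ∀ s, HasDerivAt G (G' s) s)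
    (hG'c : Continuous G') (hper : G Real.pi = G (-Real.pi)) (y : ℤ) :
    ∫ s in (-Real.pi)..Real.pi, Complex.exp (Complex.I * ((s : ℂ) * y)) * G' s =
      -(Complex.I * y) * ∫ s in (-Real.pi)..Real.pi, Complex.exp (Complex.I * ((s : ℂ) * y)) * G s := by
  have hibp := intervalIntegral.integral_mul_deriv_eq_deriv_mul (a := -Real.pi) (b := Real.pi)
    (u := fun s : ℝ => Complex.exp (Complex.I * ((s : ℂ) * y)))
    (u' := fun s : ℝ => Complex.I * y * Complex.exp (Complex.I * ((s : ℂ) * y)))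
    (v := G) (v' := G') (fun s _ => hasDerivAt_cexp_I_mul_mul (y : ℂ) s) (fun s _ => hG s)
    ((Continuous.continuousOn (by fun_prop)).intervalIntegrable) (hG'c.intervalIntegrable _ _)
  rw [hibp]
  have hbd : Complex.exp (Complex.I * ((Real.pi : ℝ) * (y : ℂ))) * G Real.pi -
      Complex.exp (Complex.I * (((-Real.pi : ℝ) : ℂ) * (y : ℂ))) * G (-Real.pi) = 0 := by
    rw [hper, Complex.ofReal_neg]
    have := cexp_I_pi_mul_int_eq y
    push_cast at this ⊢
    rw [this, sub_self]
  push_cast at hbd ⊢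
  rw [hbd, zero_sub, ← intervalIntegral.integral_neg, ← intervalIntegral.integral_const_mul]
  refine intervalIntegral.integral_congr fun s _ => ?_
  ring

/-- The iterated derivatives of a `2π`-periodic function are `2π`-periodic. [folklore] -/
theorem iteratedDeriv_periodic {F : ℝ → ℂ} (hper : Function.Periodic F (2 * Real.pi)) (m : ℕ) :
    Function.Periodic (iteratedDeriv m F) (2 * Real.pi) := by
  intro t
  have h := iteratedDeriv_comp_add_const m F (2 * Real.pi)
  have hF : (fun z => F (z + 2 * Real.pi)) = F := funext hper
  rw [hF] at h
  exact (congrFun h t).symm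

/-- **Iterated periodic integration by parts**: for a `2π`-periodic `C^m` function `F : ℝ → ℂ` and
`y ∈ ℤ`, `∫_{-π}^{π} e^{isy} F^{(m)}(s) ds = (-iy)^m ∫_{-π}^{π} e^{isy} F(s) ds` — the identity behind
`|x_j|^{2n} G(x) = (-1)^n ∫ e^{ikx} ∂_j^{2n}Ĝ(k) d^dk/(2π)^d`. [cite: Hara2008, §4.1.2 ((4.8))] -/
theorem intervalIntegral_cexp_mul_iteratedDeriv_eq {F : ℝ → ℂ} {m : ℕ} (hF : ContDiff ℝ m F)
    (hper : Function.Periodic F (2 * Real.pi)) (y : ℤ) :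
    ∫ s in (-Real.pi)..Real.pi, Complex.exp (Complex.I * ((s : ℂ) * y)) * iteratedDeriv m F s =
      (-(Complex.I * y)) ^ m *
        ∫ s in (-Real.pi)..Real.pi, Complex.exp (Complex.I * ((s : ℂ) * y)) * F s := by
  induction m with
  | zero => simp
  | succ m ih =>
    have hm : ContDiff ℝ m F := hF.of_le (by exact_mod_cast Nat.le_succ m)
    have hdiff : Differentiable ℝ (iteratedDeriv m F) :=
      hF.differentiable_iteratedDeriv m (by exact_mod_cast Nat.lt_succ_self m)
    have hderiv : ∀ s, HasDerivAt (iteratedDeriv m F) (iteratedDeriv (m + 1) F s) s := fun s => by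
      rw [iteratedDeriv_succ]
      exact (hdiff s).hasDerivAt
    have hcont : Continuous (iteratedDeriv (m + 1) F) := hF.continuous_iteratedDeriv (m + 1) le_rfl
    have hperm : iteratedDeriv m F Real.pi = iteratedDeriv m F (-Real.pi) := by
      have h := iteratedDeriv_periodic hper m (-Real.pi)
      rw [show -Real.pi + 2 * Real.pi = Real.pi by ring] at h
      exact h
    rw [intervalIntegral_cexp_mul_deriv_eq hderiv hcont hperm y, ih hm, pow_succ]
    ring

/-! ### Fubini on the cube for integrable functions -/

section Slicing

variable {n : ℕ} {E : Type*} [NormedAddCommGroup E]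

/-- Transport of integrability: `H` integrable on `[-π,π]^{n+1}` iff `H ∘ ins_l` is integrable on
`[-π,π] × [-π,π]^n` for the product of the restricted Lebesgue measures. [folklore] -/
theorem integrable_comp_insertNth_prod (l : Fin (n + 1)) {H : (Fin (n + 1) → ℝ) → E}
    (hH : IntegrableOn H (cube (n + 1))) :
    Integrable (fun p : ℝ × (Fin n → ℝ) => H (l.insertNth p.1 p.2))
      (((volume : Measure ℝ).restrict (Set.Icc (-Real.pi) Real.pi)).prod
        ((volume : Measure (Fin n → ℝ)).restrict (cube n))) := by
  set e := MeasurableEquiv.piFinSuccAbove (fun _ : Fin (n + 1) => ℝ) l with he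
  have hmp : MeasurePreserving e.symm volume volume :=
    (volume_preserving_piFinSuccAbove (fun _ : Fin (n + 1) => ℝ) l).symm
  have h1 : IntegrableOn (fun p : ℝ × (Fin n → ℝ) => H (e.symm p)) (Set.Icc (-Real.pi) Real.pi ×ˢ cube n) := by
    rw [← piFinSuccAbove_symm_preimage_cube l]
    exact (hmp.integrableOn_comp_preimage e.symm.measurableEmbedding).2 hH
  rw [Measure.prod_restrict, ← Measure.volume_eq_prod]
  exact h1

/-- **Fubini on the cube, integrable version**: for `H` integrable on `[-π,π]^{n+1}`,
`∫_{[-π,π]^{n+1}} H = ∫_{[-π,π]^n} ∫_{[-π,π]} H(ins_l(s,k')) ds dk'`. [folklore] -/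
theorem integral_cube_succ_eq_iterated_of_integrable [NormedSpace ℝ E] (l : Fin (n + 1))
    {H : (Fin (n + 1) → ℝ) → E} (hH : IntegrableOn H (cube (n + 1))) :
    ∫ k in cube (n + 1), H k =
      ∫ k' in cube n, ∫ s in Set.Icc (-Real.pi) Real.pi, H (l.insertNth s k') := by
  set e := MeasurableEquiv.piFinSuccAbove (fun _ : Fin (n + 1) => ℝ) l with he
  have hmp : MeasurePreserving e.symm volume volume :=
    (volume_preserving_piFinSuccAbove (fun _ : Fin (n + 1) => ℝ) l).symm
  have hsymm : ∀ p : ℝ × (Fin n → ℝ), e.symm p = l.insertNth p.1 p.2 := fun p => rfl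
  have h1 : ∫ k in cube (n + 1), H k = ∫ p in Set.Icc (-Real.pi) Real.pi ×ˢ cube n, H (e.symm p) := by
    rw [← piFinSuccAbove_symm_preimage_cube l, hmp.setIntegral_preimage_emb e.symm.measurableEmbedding]
  have hfun : (fun p : ℝ × (Fin n → ℝ) => H (e.symm p)) = fun p => H (l.insertNth p.1 p.2) :=
    funext fun p => by rw [hsymm]
  rw [h1, Measure.volume_eq_prod, ← Measure.prod_restrict, hfun,
    integral_prod_symm _ (integrable_comp_insertNth_prod l hH)]

/-- The transverse function `k' ↦ ∫_{[-π,π]} H(ins_l(s,k')) ds` is integrable on `[-π,π]^n`.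
[folklore] -/
theorem integrableOn_integral_slice [NormedSpace ℝ E] (l : Fin (n + 1)) {H : (Fin (n + 1) → ℝ) → E}
    (hH : IntegrableOn H (cube (n + 1))) :
    IntegrableOn (fun k' : Fin n → ℝ => ∫ s in Set.Icc (-Real.pi) Real.pi, H (l.insertNth s k'))
      (cube n) :=
  (integrable_comp_insertNth_prod l hH).integral_prod_right

/-- So is `k' ↦ ∫_{[-π,π]} ‖H(ins_l(s,k'))‖ ds`. [folklore] -/
theorem integrableOn_integral_norm_slice (l : Fin (n + 1)) {H : (Fin (n + 1) → ℝ) → E}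
    (hH : IntegrableOn H (cube (n + 1))) :
    IntegrableOn (fun k' : Fin n → ℝ => ∫ s in Set.Icc (-Real.pi) Real.pi, ‖H (l.insertNth s k')‖)
      (cube n) :=
  (integrable_comp_insertNth_prod l hH).integral_norm_prod_right

/-- For almost every transverse momentum the slice `s ↦ H(ins_l(s,k'))` is integrable on `[-π,π]`.
[folklore] -/
theorem ae_integrableOn_slice (l : Fin (n + 1)) {H : (Fin (n + 1) → ℝ) → E}
    (hH : IntegrableOn H (cube (n + 1))) :
    ∀ᵐ k' ∂(volume : Measure (Fin n → ℝ)).restrict (cube n),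
      IntegrableOn (fun s : ℝ => H (l.insertNth s k')) (Set.Icc (-Real.pi) Real.pi) :=
  (integrable_comp_insertNth_prod l hH).prod_left_ae

end Slicing

/-! ### Geometry of slices -/

section Geometry

variable {n : ℕ}

/-- `|ins_l(s,k')|² = s² + |k'|²`. [folklore] -/
theorem knorm_insertNth_sq (l : Fin (n + 1)) (s : ℝ) (k' : Fin n → ℝ) :
    knorm (l.insertNth s k' : Fin (n + 1) → ℝ) ^ 2 = s ^ 2 + knorm k' ^ 2 := by
  rw [knorm_sq, knorm_sq, Fin.sum_univ_succAbove _ l, Fin.insertNth_apply_same]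
  congr 1
  exact Finset.sum_congr rfl fun j _ => by rw [Fin.insertNth_apply_succAbove]

/-- `|k'| ≤ |ins_l(s,k')|`. [folklore] -/
theorem knorm_le_knorm_insertNth (l : Fin (n + 1)) (s : ℝ) (k' : Fin n → ℝ) :
    knorm k' ≤ knorm (l.insertNth s k' : Fin (n + 1) → ℝ) := by
  have h := knorm_insertNth_sq l s k'
  have h0 := knorm_nonneg (l.insertNth s k' : Fin (n + 1) → ℝ)
  nlinarith [knorm_nonneg k', sq_nonneg s]

/-- `ins_l(s,k') ≠ 0` when `k' ≠ 0`. [folklore] -/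
theorem insertNth_ne_zero_of_ne_zero (l : Fin (n + 1)) (s : ℝ) {k' : Fin n → ℝ} (hk' : k' ≠ 0) :
    (l.insertNth s k' : Fin (n + 1) → ℝ) ≠ 0 := by
  intro h
  apply hk'
  funext j
  have := congrFun h (l.succAbove j)
  rw [Fin.insertNth_apply_succAbove] at this
  exact this

/-- `ins_l(s,k')[l ↦ s'] = ins_l(s',k')` (a restatement of `Fin.update_insertNth` for real slices).
[folklore] -/
theorem update_insertNth_eq (l : Fin (n + 1)) (s s' : ℝ) (k' : Fin n → ℝ) :
    Function.update (l.insertNth s k' : Fin (n + 1) → ℝ) l s' = l.insertNth s' k' := by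
  simp [Fin.update_insertNth]

/-- The singleton `{0}` is null in `[-π,π]^n` for `n ≥ 1`, in `ae` form. [folklore] -/
theorem ae_restrict_cube_ne_zero (hn : 1 ≤ n) :
    ∀ᵐ k' ∂(volume : Measure (Fin n → ℝ)).restrict (cube n), k' ≠ 0 := by
  rw [show ((volume : Measure (Fin n → ℝ)).restrict (cube n)) = Slade2006Prop53.P n from
    Slade2006Prop53.volume_restrict_cube n]
  exact compl_mem_ae_iff.2 (P_singleton_zero hn)

end Geometry

/-! ### `∫_{[-π,π]^d} |k|^{-p} dk < ∞` for `p < d` -/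

variable {d : ℕ}

/-- The sup norm is dominated by the Euclidean one: `‖k‖_∞ ≤ |k|`. [folklore] -/
theorem pi_norm_le_knorm (k : Fin d → ℝ) : ‖k‖ ≤ knorm k := by
  have h := norm_sq_le_sum_sq k
  rw [← knorm_sq] at h
  exact (pow_le_pow_iff_left₀ (norm_nonneg k) (knorm_nonneg k) two_ne_zero).1 h

/-- `k ↦ ‖k‖_∞^{-p}` is integrable on sup-norm balls of `ℝ^d` for `p < d`, `d ≥ 1` (polar
coordinates: `r^{d-1} r^{-p}` is integrable at `0+` iff `d - 1 - p > -1`). [folklore] -/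
theorem integrableOn_pi_norm_rpow_neg_ball (hd : 1 ≤ d) {p : ℝ} (hp : p < d) (R : ℝ) :
    IntegrableOn (fun k : Fin d → ℝ => ‖k‖ ^ (-p)) (Metric.ball 0 R) := by
  haveI : Nontrivial (Fin d → ℝ) := by
    haveI : Nonempty (Fin d) := ⟨⟨0, by omega⟩⟩
    infer_instance
  rw [integrableOn_fun_norm_addHaar (volume : Measure (Fin d → ℝ)) (f := fun y : ℝ => y ^ (-p)) (r := R)]
  have hdim : Module.finrank ℝ (Fin d → ℝ) = d := by simp
  rw [hdim]
  have heq : Set.EqOn (fun y : ℝ => y ^ ((d : ℝ) - 1 - p)) (fun y : ℝ => y ^ (d - 1) • y ^ (-p))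
      (Set.Ioo 0 R) := by
    intro y hy
    have hy0 : 0 < y := hy.1
    simp only [smul_eq_mul]
    rw [← Real.rpow_natCast, ← Real.rpow_add hy0, Nat.cast_sub hd]
    push_cast
    ring_nf
  refine IntegrableOn.congr_fun ?_ heq measurableSet_Ioo
  rcases le_or_gt R 0 with hR | hR
  · rw [Set.Ioo_eq_empty (by exact not_lt.2 hR)]
    exact integrableOn_empty
  · have hr : (-1 : ℝ) < (d : ℝ) - 1 - p := by linarith
    have h := intervalIntegral.intervalIntegrable_rpow' (a := 0) (b := R) hr
    exact ((intervalIntegrable_iff_integrableOn_Ioc_of_le hR.le).1 h).mono_set Set.Ioo_subset_Ioc_self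

/-- **`∫_{[-π,π]^d} |k|^{-p} dk < ∞` for `0 ≤ p < d`** (`d ≥ 1`): the power counting "finite for
`2 + α < d`" of Hara's (4.9). [cite: Hara2008, §4.1.2 ((4.9))] -/
theorem integrableOn_knorm_rpow_neg (hd : 1 ≤ d) {p : ℝ} (hp0 : 0 ≤ p) (hp : p < d) :
    IntegrableOn (fun k : Fin d → ℝ => knorm k ^ (-p)) (cube d) := by
  have h1 : IntegrableOn (fun k : Fin d → ℝ => ‖k‖ ^ (-p)) (cube d) :=
    (integrableOn_pi_norm_rpow_neg_ball hd hp _).mono_set (cube_subset_ball d)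
  have hc : Continuous (knorm : (Fin d → ℝ) → ℝ) := by
    unfold knorm
    fun_prop
  refine Integrable.mono' h1 ((hc.measurable.pow_const _).aestronglyMeasurable) ?_
  refine Eventually.of_forall fun k => ?_
  rw [Real.norm_eq_abs, abs_of_nonneg (Real.rpow_nonneg (knorm_nonneg k) _)]
  rcases hp0.eq_or_lt with rfl | hp0'
  · simp
  by_cases hk : ‖k‖ = 0
  · have hk0 : k = 0 := norm_eq_zero.1 hk
    subst hk0
    have : knorm (0 : Fin d → ℝ) = 0 := by simp [knorm]
    rw [this, norm_zero]
  · have hkpos : 0 < ‖k‖ := lt_of_le_of_ne (norm_nonneg k) (Ne.symm hk)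
    rw [Real.rpow_neg (knorm_nonneg k), Real.rpow_neg (norm_nonneg k)]
    exact inv_anti₀ (Real.rpow_pos_of_pos hkpos p)
      (Real.rpow_le_rpow (norm_nonneg k) (pi_norm_le_knorm k) hp0'.le)

/-- The same with a natural exponent written as `1/|k|^q`: integrable on the cube for `q < d`.
[cite: Hara2008, §4.1.2 ((4.9))] -/
theorem integrableOn_one_div_knorm_pow (hd : 1 ≤ d) {q : ℕ} (hq : q < d) :
    IntegrableOn (fun k : Fin d → ℝ => 1 / knorm k ^ q) (cube d) := by
  have h := integrableOn_knorm_rpow_neg hd (Nat.cast_nonneg q) (by exact_mod_cast hq : (q : ℝ) < d)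
  refine h.congr_fun (fun k _ => ?_) (measurableSet_cube d)
  show knorm k ^ (-(q : ℝ)) = 1 / knorm k ^ q
  rw [Real.rpow_neg (knorm_nonneg k), Real.rpow_natCast, one_div]

end Literature.Barriers.CriticalPhenomena
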